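import Summits.QuantumAdvantage.QuantumAdvantage.Theorems.LinnikCubicClassGroupsDegreeOnePrimesEscapeUpperShadow
import Literature.NumberTheory.LFunctions.UniformClassGroupPNTTransfer
import Literature.NumberTheory.LFunctions.StarkExceptionalZero
import HarnessLib

/-!
# Crux `DegreeOnePrimesEscape` (stmt-QuantumAdvantage-11543) — dock, part 2: the lower shadow

Part 2 of the Theorems-side landing of the conditional proof of `LinnikCubicClassGroups.DegreeOnePrimesEscape`
(see part 1, `…UpperShadow.lean`); registered stub `stub_lowerShadow` of the lead's skeleton (line
`dedekind-s3-collision`).  The **lower shadow**: for every `n > 1` there is `C₁ = C₁(n)` such that for every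
number field `K` of degree `n` with no quadratic subfield and every `x ≥ Q^{C₁}` (`Q = |d_K| n^n`):
`29 · Li(x) ≤ 32 · π_K(x)` — from the Thorner–Zaman fact `ThornerZaman2019_classPNT_hilbertClassField`
and Stark's no-quadratic-subfield non-vanishing in the INEXPLICIT form `∀ n, ∃ c > 0, ∀ K` of degree `n`
without quadratic subfield, `ζ_K(σ) ≠ 0` on `[1 − c/log|d_K|, 1)`: sum the class dichotomy over ALL classes;
the `β₁`-terms cancel unless `χ₁ = 1` (`sum_hom_units_eq_zero`); if `χ₁ = 1` then `β₁` is a real zero of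
`ζ_K = L(s, 1)` (`classGroupLFunction_one`), Stark pushes it below `1 − c/log|d_K|`, so `x^{β₁−1} ≤ e^{−4}`
for `x ≥ Q^{C₁}`, and `Li(x) − Li(x^{β₁}) ≥ (x − x^{β₁})/log x` (tree) with the explicit
`Li(x) ≤ (26/25)·x/log x` for `log x ≥ 60` (`offsetLogIntegral_le_mul_div_log`, integration by parts from
the tree's `LogIntegralProofs`) finishes.
-/

noncomputable section

open scoped NumberField nonZeroDivisors
open Literature.NumberTheory.LFunctions Literature.NumberTheory.LFunctions.NumberField

namespace Summit.QuantumAdvantage.QuantumAdvantage.Theorems.DegreeOnePrimesEscape.Dock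

/-- **An explicit upper bound for `Li`**: `Li(x) ≤ (26/25) · x/log x` once `log x ≥ 60`
(integration by parts `Li = x/log x − 2/log 2 + Li₂`, and `Li₂(x) ≤ Li₂(√x) + 2 Li(x)/log x`,
`Li₂(√x) ≤ (√x − 2)/log² 2`, all from the tree's `LogIntegralProofs`). [folklore] -/
theorem offsetLogIntegral_le_mul_div_log {x : ℝ} (hx : Real.exp 60 ≤ x) :
    offsetLogIntegral x ≤ 26 / 25 * (x / Real.log x) := by
  have he : (1 : ℝ) ≤ Real.exp 60 := Real.one_le_exp (by norm_num)
  have hx1 : (1 : ℝ) < x := by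
    have : (1:ℝ) < Real.exp 60 := by
      have := Real.add_one_le_exp (60:ℝ); linarith
    linarith
  have hx0 : 0 < x := by linarith
  have hlogx : 60 ≤ Real.log x := (Real.le_log_iff_exp_le hx0).2 hx
  have hlogpos : 0 < Real.log x := by linarith
  -- √x
  have hsqrt_sq : Real.sqrt x ^ 2 = x := Real.sq_sqrt hx0.le
  have hsqrt1 : (1 : ℝ) < Real.sqrt x := by
    rw [show (1:ℝ) = Real.sqrt 1 by simp]; exact Real.sqrt_lt_sqrt (by norm_num) hx1
  have hlog_sqrt : Real.log (Real.sqrt x) = Real.log x / 2 := by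
    rw [Real.log_sqrt hx0.le]
  -- e^{30} ≤ √x, hence 3000 · √x ≤ x / log x is not needed in this crude form; we use √x · 200 ≤ x/ log x
  have hsqrt_ge : Real.exp 30 ≤ Real.sqrt x := by
    rw [show Real.exp 30 = Real.sqrt (Real.exp 60) by
      rw [show (60:ℝ) = 30 + 30 by norm_num, Real.exp_add, Real.sqrt_mul_self (Real.exp_pos _).le]]
    exact Real.sqrt_le_sqrt hx
  have h2sqrt : (2 : ℝ) ≤ Real.sqrt x := by
    have : (2:ℝ) ≤ Real.exp 30 := by have := Real.add_one_le_exp (30:ℝ); linarith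
    linarith
  have hsqrt_le : Real.sqrt x ≤ x := by nlinarith
  -- (1) integration by parts
  have hparts := offsetLogIntegralPow_integration_by_parts 1 hx1
  rw [offsetLogIntegralPow_one] at hparts
  simp only [pow_one, Nat.cast_one, one_mul] at hparts
  -- (2) Li₂ x ≤ Li₂ √x + (log √x)⁻¹ Li x
  have hsucc := offsetLogIntegralPow_succ_le 1 h2sqrt hsqrt_le
  rw [offsetLogIntegralPow_one, hlog_sqrt] at hsucc
  -- (3) Li₂ √x ≤ (log 2)⁻¹ Li₁ √x ≤ (log 2)⁻² (√x − 2)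
  have hA := offsetLogIntegralPow_succ_le 1 (le_refl (2:ℝ)) h2sqrt
  have hB := offsetLogIntegralPow_succ_le 0 (le_refl (2:ℝ)) h2sqrt
  simp only [offsetLogIntegralPow_two, zero_add] at hA hB
  rw [offsetLogIntegralPow_zero] at hB
  rw [offsetLogIntegralPow_one] at hA hB
  have hlog2 : (0.6931471803 : ℝ) < Real.log 2 := Real.log_two_gt_d9
  have hl2pos : 0 < Real.log 2 := by linarith
  have hinv2 : (Real.log 2)⁻¹ ≤ 3 / 2 := by
    rw [inv_le_comm₀ hl2pos (by norm_num)]; linarith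
  have hLi_sqrt_nonneg : 0 ≤ offsetLogIntegral (Real.sqrt x) := by
    have := sub_mul_inv_log_pow_le_offsetLogIntegralPow 1 h2sqrt
    rw [offsetLogIntegralPow_one] at this
    have h0 : 0 ≤ (Real.sqrt x - 2) * (Real.log (Real.sqrt x))⁻¹ ^ 1 := by
      apply mul_nonneg (by linarith)
      apply pow_nonneg; apply inv_nonneg.2; apply Real.log_nonneg hsqrt1.le
    linarith
  -- Li₂ √x ≤ (3/2) Li √x ≤ (3/2)(3/2)(√x − 2) ≤ (9/4) √x
  have hLi2sqrt : offsetLogIntegralPow 2 (Real.sqrt x) ≤ 9 / 4 * Real.sqrt x := by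
    have h1 : offsetLogIntegralPow 2 (Real.sqrt x) ≤ 3 / 2 * offsetLogIntegral (Real.sqrt x) := by
      calc offsetLogIntegralPow 2 (Real.sqrt x) ≤ (Real.log 2)⁻¹ * offsetLogIntegral (Real.sqrt x) := hA
        _ ≤ 3 / 2 * offsetLogIntegral (Real.sqrt x) := by gcongr
    have h2 : offsetLogIntegral (Real.sqrt x) ≤ 3 / 2 * (Real.sqrt x - 2) := by
      calc offsetLogIntegral (Real.sqrt x) ≤ (Real.log 2)⁻¹ * (Real.sqrt x - 2) := hB
        _ ≤ 3 / 2 * (Real.sqrt x - 2) := by gcongr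
    nlinarith
  -- combine: Li x = x/log x − 2/log 2 + Li₂ x ≤ x/log x + 9/4 √x + (2/log x) Li x
  have hLi2x : offsetLogIntegralPow 2 x ≤ 9 / 4 * Real.sqrt x + (2 / Real.log x) * offsetLogIntegral x := by
    have : (Real.log x / 2)⁻¹ = 2 / Real.log x := by rw [inv_div]
    rw [this] at hsucc
    linarith
  have hmain : offsetLogIntegral x * (1 - 2 / Real.log x) ≤ x / Real.log x + 9 / 4 * Real.sqrt x := by
    have h2l : 0 ≤ 2 * (Real.log 2)⁻¹ := by positivity
    have : offsetLogIntegral x ≤ x * (Real.log x)⁻¹ + offsetLogIntegralPow 2 x := by linarith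
    rw [← div_eq_mul_inv] at this
    nlinarith
  -- 9/4 √x ≤ (1/1000) x / log x, via u = x^{1/4} ≥ e^{15} ≥ 9000 and log x ≤ 4u
  have hsmall : 9 / 4 * Real.sqrt x ≤ 1 / 1000 * (x / Real.log x) := by
    have hsx0 : 0 ≤ Real.sqrt x := by linarith
    set u : ℝ := (Real.sqrt x) ^ ((1:ℝ)/2) with hu
    have hu2 : u * u = Real.sqrt x := by
      rw [hu, ← Real.rpow_add (by linarith)]; norm_num
    have hu_ge : Real.exp 15 ≤ u := by
      have : Real.exp 15 = (Real.exp 30) ^ ((1:ℝ)/2) := by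
        rw [← Real.exp_mul]; norm_num
      rw [this, hu]
      exact Real.rpow_le_rpow (Real.exp_pos _).le hsqrt_ge (by norm_num)
    have he15 : (9000 : ℝ) ≤ Real.exp 15 := by
      have h1 : Real.exp 15 = Real.exp 1 ^ 15 := by
        rw [← Real.exp_nat_mul]; norm_num
      have h2 : (2.7 : ℝ) ≤ Real.exp 1 := le_of_lt (lt_trans (by norm_num) Real.exp_one_gt_d9)
      rw [h1]
      calc (9000 : ℝ) ≤ 2.7 ^ 15 := by norm_num
        _ ≤ Real.exp 1 ^ 15 := pow_le_pow_left₀ (by norm_num) h2 15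
    have hu9000 : (9000 : ℝ) ≤ u := le_trans he15 hu_ge
    have hupos : 0 < u := by linarith
    have hl : Real.log (Real.sqrt x) ≤ (Real.sqrt x) ^ ((1:ℝ)/2) / ((1:ℝ)/2) :=
      Real.log_le_rpow_div hsx0 (by norm_num)
    have hlogx_le : Real.log x ≤ 4 * u := by
      have h1 : Real.log x = 2 * Real.log (Real.sqrt x) := by rw [hlog_sqrt]; ring
      have h2 : Real.log (Real.sqrt x) ≤ 2 * u := by
        calc Real.log (Real.sqrt x) ≤ u / ((1:ℝ)/2) := hl
          _ = 2 * u := by ring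
      linarith
    have hx_u : x = (u * u) * (u * u) := by
      calc x = Real.sqrt x ^ 2 := hsqrt_sq.symm
        _ = (u * u) * (u * u) := by rw [← hu2]; ring
    have hdiv : x / (4 * u) ≤ x / Real.log x :=
      div_le_div_of_nonneg_left hx0.le hlogpos hlogx_le
    have hkey : 9 / 4 * Real.sqrt x ≤ 1 / 1000 * (x / (4 * u)) := by
      rw [← hu2, hx_u]
      have : 1 / 1000 * ((u * u) * (u * u) / (4 * u)) = u ^ 3 / 4000 := by
        field_simp; ring
      rw [this]
      nlinarith [hu9000, hupos]
    calc 9 / 4 * Real.sqrt x ≤ 1 / 1000 * (x / (4 * u)) := hkey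
      _ ≤ 1 / 1000 * (x / Real.log x) := by gcongr
  -- finish: Li x (1 − 2/log x) ≤ (1 + 1/1000) x/log x and 1 − 2/log x ≥ 29/30
  have hfac : (29:ℝ)/30 ≤ 1 - 2 / Real.log x := by
    have : 2 / Real.log x ≤ 1 / 30 := by
      rw [div_le_iff₀ hlogpos]; linarith
    linarith
  have hxl : 0 ≤ x / Real.log x := by positivity
  by_cases hLi : offsetLogIntegral x ≤ 0
  · linarith
  · rw [not_le] at hLi
    have h1 : offsetLogIntegral x * (29 / 30) ≤ 1001 / 1000 * (x / Real.log x) := by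
      calc offsetLogIntegral x * (29 / 30) ≤ offsetLogIntegral x * (1 - 2 / Real.log x) := by
            gcongr
        _ ≤ x / Real.log x + 9 / 4 * Real.sqrt x := hmain
        _ ≤ 1001 / 1000 * (x / Real.log x) := by linarith
    linarith

end Summit.QuantumAdvantage.QuantumAdvantage.Theorems.DegreeOnePrimesEscape.Dock

namespace Summit.QuantumAdvantage.QuantumAdvantage.Theorems.DegreeOnePrimesEscape
set_option maxHeartbeats 400000 in
/-- **F_low, PROVED from the in-tree Thorner–Zaman fact and the INEXPLICIT Stark non-vanishing**
(inexplicit Stark form; registered stub `stub_lowerShadow`, line `dedekind-s3-collision`): sum the class dichotomy over all classes; the `β₁`-terms cancel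
unless `χ₁ = 1` (`sum_hom_units_eq_zero`); if `χ₁ = 1`, `β₁` is a real zero of
`ζ_K = L(s, 1)` (`classGroupLFunction_one`), Stark pushes it below `1 − c/log|d_K|`, so
`x^{β₁−1} ≤ e^{−c C₁} ≤ e^{−4}` for `x ≥ Q^{C₁}`, and `Li(x) − Li(x^{β₁}) ≥ (x − x^{β₁})/log x`
(tree) with `Li(x) ≤ (26/25) x/log x` (above) finishes. -/
theorem stub_lowerShadow : ThornerZaman2019_classPNT_hilbertClassField →
    (∀ n : ℕ, ∃ c : ℝ, 0 < c ∧ ∀ (K : Type) [Field K] [NumberField K], Module.finrank ℚ K = n →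
      (∀ F : IntermediateField ℚ K, Module.finrank ℚ F ≠ 2) →
      ∀ σ : ℝ, 1 - c / Real.log ((NumberField.discr K).natAbs : ℝ) ≤ σ → σ < 1 →
        dedekindZetaCont K σ ≠ 0) →
    ∀ n : ℕ, 1 < n → ∃ C₁ : ℝ, ∀ (K : Type) [Field K] [NumberField K], Module.finrank ℚ K = n →
      (∀ F : IntermediateField ℚ K, Module.finrank ℚ F ≠ 2) →
      ∀ x : ℝ, ThornerZaman.condQn K ^ C₁ ≤ x →
        29 * offsetLogIntegral x ≤ 32 * (primeIdealCount K x : ℝ) := by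
  intro hTZ hSt
  classical
  obtain ⟨c₁, c₂, c₃, hc₁, hc₂, hc₃, H⟩ := hTZ
  intro n hn
  obtain ⟨c, hc, hS⟩ := hSt n
  set L : ℝ := max 1 (Real.log (64 * c₃)) with hLdef
  refine ⟨max (max c₁ 44) (max (max (L / c₂) (L ^ 2 / (c₂ * Real.log 2))) (4 / c)), ?_⟩
  intro K _ _ hKn hnq x hx
  have hK : 1 < Module.finrank ℚ K := by rw [hKn]; exact hn
  set C₁ : ℝ := max (max c₁ 44) (max (max (L / c₂) (L ^ 2 / (c₂ * Real.log 2))) (4 / c)) with hC₁def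
  set Q : ℝ := ThornerZaman.condQn K with hQdef
  set h : ℕ := NumberField.classNumber K with hhdef
  -- basic sizes
  have hQ12 : 12 ≤ Q := ThornerZaman.twelve_le_condQn (K := K) hK
  have hQ1 : 1 ≤ Q := by linarith
  have hQpos : 0 < Q := by linarith
  have hC₁c₁ : c₁ ≤ C₁ := le_trans (le_max_left _ _) (le_max_left _ _)
  have hC₁44 : 44 ≤ C₁ := le_trans (le_max_right _ _) (le_max_left _ _)
  have hC₁c : 4 / c ≤ C₁ := le_trans (le_max_right _ _) (le_max_right _ _)
  have hC₁0 : 0 ≤ C₁ := by linarith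
  have hxc₁ : Q ^ c₁ ≤ x := le_trans (Real.rpow_le_rpow_of_exponent_le hQ1 hC₁c₁) hx
  have hxpos : 0 < x := lt_of_lt_of_le (Real.rpow_pos_of_pos hQpos _) hx
  have hlogx : C₁ * Real.log Q ≤ Real.log x := by
    have := Real.log_le_log (Real.rpow_pos_of_pos hQpos _) hx
    rwa [Real.log_rpow hQpos] at this
  have hlog2 : (0.6931471803 : ℝ) < Real.log 2 := Real.log_two_gt_d9
  have hlogQ2 : 2 * Real.log 2 ≤ Real.log Q := by
    have h1 := Dock.finrank_mul_log_two_le_log_condQn K hK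
    have h2 : (2 : ℝ) ≤ Module.finrank ℚ K := by exact_mod_cast hK
    nlinarith
  have hlogQpos : 0 < Real.log Q := by linarith
  have hlogx60 : 60 ≤ Real.log x := by nlinarith
  have hx_exp : Real.exp 60 ≤ x := (Real.le_log_iff_exp_le hxpos).1 hlogx60
  have hx1 : 1 < x := by
    have : (1:ℝ) < Real.exp 60 := by have := Real.add_one_le_exp (60:ℝ); linarith
    linarith
  have hlogxpos : 0 < Real.log x := by linarith
  have hE : c₃ * ThornerZaman.errorTermN c₂ Q (Module.finrank ℚ K) x ≤ 1 / 32 :=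
    Dock.errorTermN_le_of_ge hc₂ hc₃
      (le_trans (le_trans (le_max_left _ _) (le_max_left _ _)) (le_max_right _ _))
      (le_trans (le_trans (le_max_right _ _) (le_max_left _ _)) (le_max_right _ _)) K hK hx
  have hEpos : 0 < c₃ * ThornerZaman.errorTermN c₂ Q (Module.finrank ℚ K) x :=
    mul_pos hc₃ (ThornerZaman.errorTermN_pos _ _ _ _)
  have hLiup : offsetLogIntegral x ≤ 26 / 25 * (x / Real.log x) :=
    Dock.offsetLogIntegral_le_mul_div_log hx_exp
  have hxl : 0 ≤ x / Real.log x := by positivity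
  -- per-class lower bound
  have key : ∀ (π m : ℝ), |π - m| ≤ c₃ * ThornerZaman.errorTermN c₂ Q (Module.finrank ℚ K) x * m →
      31 / 32 * m ≤ π := by
    intro π m hπ
    have hm : 0 ≤ m := by
      by_contra hneg
      rw [not_le] at hneg
      have : c₃ * ThornerZaman.errorTermN c₂ Q (Module.finrank ℚ K) x * m < 0 := mul_neg_of_pos_of_neg hEpos hneg
      linarith [abs_nonneg (π - m)]
    have h1 := (abs_sub_le_iff.1 hπ).2
    nlinarith
  -- total count
  have htot : (primeIdealCount K x : ℝ) = ∑ C : ClassGroup (𝓞 K), (primeIdealClassCount K C x : ℝ) := by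
    exact_mod_cast Dock.primeIdealCount_eq_sum_classCount K x
  have hcardC : ((Finset.univ : Finset (ClassGroup (𝓞 K))).card : ℝ) = h := by
    rw [Finset.card_univ, hhdef, NumberField.classNumber]
  have hhpos : (0 : ℝ) < h := by exact_mod_cast NumberField.classNumber_pos (K := K)
  rcases H K hK with ⟨-, hA⟩ | ⟨χ₁, β₁, -, hβlo, hβhi, hzero, hB⟩
  · -- no exceptional zero: π_K ≥ (31/32) Li
    have hC : ∀ C : ClassGroup (𝓞 K),
        31 / 32 * (offsetLogIntegral x / h) ≤ (primeIdealClassCount K C x : ℝ) :=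
      fun C => key _ _ (hA C x hxc₁)
    have hπ : 31 / 32 * offsetLogIntegral x ≤ (primeIdealCount K x : ℝ) := by
      rw [htot]
      calc 31 / 32 * offsetLogIntegral x
          = ∑ C : ClassGroup (𝓞 K), 31 / 32 * (offsetLogIntegral x / h) := by
            rw [Finset.sum_const, nsmul_eq_mul, hcardC]; field_simp
        _ ≤ ∑ C : ClassGroup (𝓞 K), (primeIdealClassCount K C x : ℝ) :=
            Finset.sum_le_sum fun C _ => hC C
    have hLix : 0 ≤ offsetLogIntegral x := by
      have h2 : (2:ℝ) ≤ x := by have := Real.add_one_le_exp (60:ℝ); linarith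
      have := sub_mul_inv_log_pow_le_offsetLogIntegralPow 1 h2
      rw [offsetLogIntegralPow_one] at this
      have h0 : 0 ≤ (x - 2) * (Real.log x)⁻¹ ^ 1 := by
        apply mul_nonneg (by linarith); positivity
      linarith
    linarith only [hπ, hLix]
  · -- exceptional (χ₁, β₁)
    have hC : ∀ C : ClassGroup (𝓞 K), 31 / 32 *
        ((offsetLogIntegral x - ((χ₁ C : ℂ)).re * offsetLogIntegral (x ^ β₁)) / h)
          ≤ (primeIdealClassCount K C x : ℝ) :=
      fun C => key _ _ (hB C x hxc₁)
    have hsumπ : 31 / 32 * ∑ C : ClassGroup (𝓞 K),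
        (offsetLogIntegral x - ((χ₁ C : ℂ)).re * offsetLogIntegral (x ^ β₁)) / h
          ≤ (primeIdealCount K x : ℝ) := by
      rw [htot, Finset.mul_sum]
      exact Finset.sum_le_sum fun C _ => hC C
    have hsum : ∑ C : ClassGroup (𝓞 K),
        (offsetLogIntegral x - ((χ₁ C : ℂ)).re * offsetLogIntegral (x ^ β₁)) / (h : ℝ)
        = ((h : ℝ) * offsetLogIntegral x
            - (∑ C : ClassGroup (𝓞 K), ((χ₁ C : ℂ)).re) * offsetLogIntegral (x ^ β₁)) / h := by
      rw [← Finset.sum_div, Finset.sum_sub_distrib, Finset.sum_const, nsmul_eq_mul, Finset.sum_mul,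
        hcardC]
    -- Li(x) ≥ 0 and the two subcases
    have hx2 : (2:ℝ) ≤ x := by have := Real.add_one_le_exp (60:ℝ); linarith
    have hLix : 0 ≤ offsetLogIntegral x := by
      have := sub_mul_inv_log_pow_le_offsetLogIntegralPow 1 hx2
      rw [offsetLogIntegralPow_one] at this
      have h0 : 0 ≤ (x - 2) * (Real.log x)⁻¹ ^ 1 := by
        apply mul_nonneg (by linarith); positivity
      linarith
    by_cases hχ1 : χ₁ = 1
    · -- χ₁ trivial: β₁ is a zero of ζ_K; Stark pushes it left
      subst hχ1
      have hre : ∑ C : ClassGroup (𝓞 K), (((1 : ClassGroup (𝓞 K) →* ℂˣ) C : ℂ)).re = h := by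
        simp only [MonoidHom.one_apply, Units.val_one, Complex.one_re, Finset.sum_const,
          nsmul_eq_mul, mul_one]
        exact hcardC
      rw [hre] at hsum
      have hmain : ∑ C : ClassGroup (𝓞 K),
          (offsetLogIntegral x - (((1 : ClassGroup (𝓞 K) →* ℂˣ) C : ℂ)).re * offsetLogIntegral (x ^ β₁)) / (h : ℝ)
          = offsetLogIntegral x - offsetLogIntegral (x ^ β₁) := by
        rw [hsum]; field_simp
      rw [hmain] at hsumπ
      -- Stark
      have hβ1c : (β₁ : ℂ) ≠ 1 := by
        intro heq
        have := congrArg Complex.re heq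
        simp at this
        linarith
      have hzeta : dedekindZetaCont K β₁ = 0 := by
        rw [← classGroupLFunction_one K hβ1c]; exact hzero
      set d : ℝ := ((NumberField.discr K).natAbs : ℝ) with hddef
      have hd_eq : d = |(NumberField.discr K : ℝ)| := by
        rw [hddef, Nat.cast_natAbs, Int.cast_abs]
      have hd3 : (3 : ℝ) ≤ d := by
        have h2 := NumberField.abs_discr_gt_two hK
        rw [hd_eq, ← Int.cast_abs]
        exact_mod_cast (show (3:ℤ) ≤ |NumberField.discr K| by omega)
      have hdpos : 0 < d := by linarith
      have hlogd : 0 < Real.log d := Real.log_pos (by linarith)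
      have hdQ : d ≤ Q := by
        rw [hQdef, ThornerZaman.condQn, hd_eq]
        have hn1 : (1:ℝ) ≤ (Module.finrank ℚ K : ℝ) ^ Module.finrank ℚ K :=
          one_le_pow₀ (by exact_mod_cast hK.le)
        have h0 : 0 ≤ |(NumberField.discr K : ℝ)| := abs_nonneg _
        nlinarith
      have hlogdQ : Real.log d ≤ Real.log Q := Real.log_le_log hdpos hdQ
      have hβup : β₁ < 1 - c / Real.log d := by
        by_contra hcon
        rw [not_lt] at hcon
        exact hS K hKn hnq β₁ hcon hβhi hzeta
      -- (1 − β₁) log x ≥ 4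
      have hgap : 4 ≤ (1 - β₁) * Real.log x := by
        have h1 : c / Real.log d ≤ 1 - β₁ := by linarith only [hβup]
        have hcd : 0 ≤ c / Real.log d := div_nonneg hc.le hlogd.le
        have h2 : c / Real.log d * (C₁ * Real.log d) = c * C₁ := by
          field_simp
        have h3 : c / Real.log d * (C₁ * Real.log d) ≤ c / Real.log d * Real.log x := by
          apply mul_le_mul_of_nonneg_left _ hcd
          have : C₁ * Real.log d ≤ C₁ * Real.log Q := mul_le_mul_of_nonneg_left hlogdQ hC₁0
          linarith only [this, hlogx]
        have h4 : 4 ≤ c * C₁ := by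
          have := (div_le_iff₀ hc).1 hC₁c; linarith only [this]
        have h5 : c / Real.log d * Real.log x ≤ (1 - β₁) * Real.log x :=
          mul_le_mul_of_nonneg_right h1 hlogxpos.le
        linarith only [h2, h3, h4, h5]
      -- x^{β₁} ≤ x / 50
      have hβpos : 0 < β₁ := by
        have hlQ1 : 1 ≤ Real.log Q := by linarith only [hlogQ2, hlog2]
        have : 1 / (8 * Real.log Q) ≤ 1 / 8 :=
          one_div_le_one_div_of_le (by norm_num) (by linarith only [hlQ1])
        linarith only [this, hβlo]
      have hxβ : x ^ β₁ ≤ x / 50 := by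
        have h1 : x ^ β₁ = x ^ (β₁ - 1) * x := by
          rw [← Real.rpow_add_one hxpos.ne' (β₁ - 1)]; norm_num
        have h2 : x ^ (β₁ - 1) ≤ Real.exp (-4) := by
          rw [Real.rpow_def_of_pos hxpos]
          apply Real.exp_le_exp.2
          nlinarith only [hgap]
        have h3 : Real.exp (-4) ≤ 1 / 50 := by
          rw [Real.exp_neg]
          have h50 : (50:ℝ) ≤ Real.exp 4 := by
            have e1 : Real.exp 4 = Real.exp 1 ^ 4 := by rw [← Real.exp_nat_mul]; norm_num
            have e2 : (2.7 : ℝ) ≤ Real.exp 1 := le_of_lt (lt_trans (by norm_num) Real.exp_one_gt_d9)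
            rw [e1]
            calc (50:ℝ) ≤ 2.7 ^ 4 := by norm_num
              _ ≤ Real.exp 1 ^ 4 := pow_le_pow_left₀ (by norm_num) e2 4
          rw [inv_eq_one_div, div_le_div_iff₀ (Real.exp_pos 4) (by norm_num)]
          linarith
        rw [h1]
        have : x ^ (β₁ - 1) * x ≤ (1 / 50) * x := by
          apply mul_le_mul_of_nonneg_right (le_trans h2 h3) hxpos.le
        linarith only [this]
      -- Li x − Li x^β ≥ (x − x^β)/log x ≥ (49/50) x / log x
      have hdiff : (x - x ^ β₁) / Real.log x ≤ offsetLogIntegral x - offsetLogIntegral (x ^ β₁) :=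
        sub_rpow_div_log_le_offsetLogIntegral_sub hx1 hβpos hβhi.le
      have hdiff2 : 49 / 50 * (x / Real.log x) ≤ (x - x ^ β₁) / Real.log x := by
        rw [mul_div_assoc', div_le_div_iff_of_pos_right hlogxpos]
        linarith only [hxβ]
      -- assemble: 8 π_K ≥ 8 (31/32)(49/50)(x/log x) ≥ 7 (26/25)(x / log x) ≥ 7 Li
      linarith only [hsumπ, hdiff, hdiff2, hLiup, hxl]
    · -- χ₁ nontrivial: the β₁-terms cancel
      have hψ : (Units.coeHom ℂ).comp χ₁ ≠ 1 := by
        intro heq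
        apply hχ1
        ext C
        have := DFunLike.congr_fun heq C
        simpa using this
      have hre : ∑ C : ClassGroup (𝓞 K), ((χ₁ C : ℂ)).re = 0 := by
        have h0 := sum_hom_units_eq_zero ((Units.coeHom ℂ).comp χ₁) hψ
        rw [← Complex.re_sum]
        have : ∑ C : ClassGroup (𝓞 K), (χ₁ C : ℂ) = ∑ C : ClassGroup (𝓞 K), ((Units.coeHom ℂ).comp χ₁) C := by
          apply Finset.sum_congr rfl; intro C _; rfl
        rw [this, h0, Complex.zero_re]
      rw [hre] at hsum
      have hmain : ∑ C : ClassGroup (𝓞 K),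
          (offsetLogIntegral x - ((χ₁ C : ℂ)).re * offsetLogIntegral (x ^ β₁)) / (h : ℝ)
          = offsetLogIntegral x := by
        rw [hsum, zero_mul, sub_zero, mul_div_assoc, mul_div_cancel₀ _ hhpos.ne']
      rw [hmain] at hsumπ
      linarith only [hsumπ, hLix]

end Summit.QuantumAdvantage.QuantumAdvantage.Theorems.DegreeOnePrimesEscape

end
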